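import Literature.AnabelianGeometry.SemiGraphs.MetabelianLeafStarEscapeSelfMaximal
import Literature.AnabelianGeometry.SemiGraphs.TemperedPiLimitHom
import Literature.AnabelianGeometry.SemiGraphs.TemperedReconstructionCor39UpToTwistRefutation
import Literature.AnabelianGeometry.SemiGraphs.TemperedReconstructionCor39AsymmetricTopCyclic
import HarnessLib

/-!
# [SemiAnbd] Corollary 3.9 (b), up to twist, with TARGET the rayless star `𝒢⋆(p)`: the Thm-3.7-(iii)-side
# quadrant FAILS — a parametrised exotic maximal compact subgroup and the one-vertex fold onto it
# (row «COR39b-(iii)-SIDE@RAYLESS-STAR»)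

Mochizuki, *Semi-graphs of anabelioids*, Publ. RIMS **42** (2006), §3, Definition 3.8 and Corollary 3.9 with its
proof, manuscript pp. 42–43 (proof p. 43 l. 13–15: "[again by Theorem 3.7, (iii), (iv)]"); Theorem 3.7 (iii)/(iv)
pp. 40–41 [cite: MochizukiSemiAnbd2006, Cor 3.9 pp.42-43].

PROOF-ONLY file (abc-iut cell, layer L3, seat abc-iut-L3-t10 gen 14; 0 definitions, no named fact; LF-SGA cell
F-1710 / F-2771; inputs BY NAME: abc-iut-L3-t8 (`MetabelianLeafStarEscapeElement` / `…EscapeSelfMaximal`: the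
elements `c_k`, `proj_escC_succ`, `escape_isMaximalCompactSubgroup`), abc-iut-f-175 (`TemperedPiLimitHom`;
`TemperedReconstructionCompatRefutation`: the one-vertex fold at `𝒢_θ`), abc-iut-w6-d064 (`MetabelianLeafStarCor39`),
this lineage p501002 (`TemperedReconstructionCor39AsymmetricTopCyclic`)).  At `𝒢⋆(p) = metabelianLeafStar p` (centre
`F̂₂⁽ᵖ⁾`, countably many metabelian Iwahori leaves, edge groups `ℤ_p`; NOT locally finite; Thm. 3.7 (iii) FAILS:
the escaping `⟨c⟩‾ ≅ ℤ_p` is a commutative MAXIMAL compact subgroup in no verticial subgroup, p499850) p501002 proved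
the two (iii)-FREE quadrants of Cor. 3.9 up to twist ((a) with TARGET `𝒢⋆(p)`, (b) with SOURCE `𝒢⋆(p)`, any partner
satisfying Thm. 3.7 (iii)) and banked the two (iii)-SIDE quadrants.  THIS FILE DECIDES THE (b)-QUADRANT WITH TARGET
`𝒢⋆(p)` — NEGATIVELY, already for a FINITE one-vertex partner:

* §1 ★ `metabelianLeafStar_exists_escapeHom` — a CONTINUOUS `ζ : ℤ_p →ₜ* π₁^temp(𝒢⋆(p))` (canonical chart, every
  prime `p`, hypothesis-free) with `ρ_j(ζ 1) = ρ_j(c_k)` for `k ≥ N_j` whose RANGE `⟨ζ 1⟩‾` is a MAXIMAL compact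
  subgroup in NO verticial subgroup: abc-iut-f-175's limit (`exists_limitHom_range`) of `ζ_k := Inn(h_k) ∘ ψ_{P₀} ∘ α`
  (`α(t) = aᵗ`, `ζ_k(1) = c_k`, level-wise eventually constant by `proj_escC_succ`), then abc-iut-L3-t8's
  `escape_isMaximalCompactSubgroup` (stated for any such limit) — the PARAMETRISED form of abc-iut-L3-t8's
  `metabelianLeafStar_exists_procyclic_exotic_maximalCompact`; hypothesis-free package `…_range_isMaximalCompact` (+ `_chart`).
* §2 at the pair (`OneVertex.graph F̂₂⁽ᵖ⁾`, `𝒢⋆(p)`) (abc-iut-L3-t2's explicit source chart, EVERY chart of the star):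
  `φ := ζ ∘ χ_a` is COMPATIBLY QUASI-GEOMETRIC (abc-iut-f-175: the only maximal compact subgroup of the compact source is
  `⊤`, mapped ONTO the maximal compact `⟨ζ 1⟩‾`) and compatible on verticial homomorphisms with NO morphism
  (`not_compatV_of_range_not_le`), hence induced (up to twist) by none: ★ `oneVertex_metabelianLeafStar_not_cor39b` —
  CLAUSE (b) OF COR. 3.9 UP TO TWIST FAILS AT THE PAIR, while clause (a) HOLDS there (finite source, p501002):
  ★ `oneVertex_metabelianLeafStar_cor39a_and_not_cor39b` — mirror image of this lineage's pair (`𝒢_θ`, `loopGraph p`)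
  (p496623: (a) fails, (b) holds).
* §3 ★ `not_forall_topCyclic_cor39b`: clause (b) does NOT hold at every pair of Cor-3.9 graphs all of whose edge
  groups are topologically cyclic, even with Thm. 3.7 (iii) AT THE SOURCE — in p501002's
  `cor39b_upToTwist_baseAt_of_topCyclic_source` the input «Thm. 3.7 (iii) at the TARGET» is NECESSARY (the top-cyclic
  cell is sharp on the (iii)-side, as the locally finite cell was: p493595, witness `𝒢_θ`); contrast
  `forall_topCyclic_source_cor39b_of_compactInVerticialAt_target`.  ★ `exists_edgeLikeCentralizerAt_…_not_cor39b`: at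
  the TARGET, sentence 1 of Thm. 3.7 (iii) cannot be traded for «(R3c) `EdgeLikeCentralizerAt` at every chart +
  topologically cyclic edge groups» (both hold at `𝒢⋆(p)`, abc-iut-w6-d064).  ★ `metabelianLeafStar_cor39UpToTwist_quadrants`:
  the table — (a)-target ✓, (b)-source ✓ (p501002), (b)-target ✗ already for a finite Thm-3.7-(iii) partner (here).
  NOT decided: (a) with source `𝒢⋆(p)`; (b) with target `𝒢⋆(p)` for sources in which every vertex carries an edge
  (e.g. (`𝒢⋆(p)`, `𝒢⋆(p)`)), hinging on abc-iut-L3-t8's banked «C₀-ISOLATED@STAR» (does every maximal compact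
  `K ≠ ⟨c⟩‾` meet `⟨c⟩‾` trivially?) — a question about the `ζ` of §1 (`⟨c^{p^s}⟩‾ = ζ(p^s ℤ_p)`).

HONEST FRAMING: OUR rendering at OUR typed objects (∀-countable typing of Cor. 3.9; the witness is an infinite graph
of anabelioids where «maximal compact = verticial» fails); outside the [IUTchIII] Cor. 3.12 cone (every print consumer
of Cor. 3.9 has a finite dual graph, where (b) is a theorem: `cor39CompatUpToTwistAt_of_finite`); Cor. 3.9 as printed
and as used is not claimed false; nothing asserts abc proved or refuted; no side on [IUTchIII] Cor. 3.12; typed ≠ proved.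
-/

noncomputable section

open CategoryTheory Topology Multiplicative

namespace Literature.AnabelianGeometry.SemiGraphs

section Transport

variable {A B : Type} [Group A] [TopologicalSpace A] [Group B] [TopologicalSpace B]

/-- An isomorphism of topological groups carries maximal compact subgroups to maximal compact subgroups (local copy
of the folklore transport used in abc-iut-L3-t8's files B1/C; the notion of Thm 3.7 (iv) / Def 3.8 is intrinsic to the
topological group). [cite: MochizukiSemiAnbd2006, Thm 3.7(iv) p.41] -/
private theorem isMaximalCompactSubgroup_map_equiv (e : A ≃ₜ* B) {K : Subgroup A}
    (hK : IsMaximalCompactSubgroup K) : IsMaximalCompactSubgroup (K.map e.toMonoidHom) := by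
  refine ⟨?_, fun K' hK' hle => ?_⟩
  · rw [Subgroup.coe_map]
    exact hK.1.image e.continuous
  · have hK'c : IsCompact ((K'.map e.symm.toMonoidHom : Subgroup A) : Set A) := by
      rw [Subgroup.coe_map]
      exact hK'.image e.symm.continuous
    have hle' : K ≤ K'.map e.symm.toMonoidHom := fun x hx =>
      ⟨e x, hle ⟨x, hx, rfl⟩, e.symm_apply_apply x⟩
    have heq := hK.2 _ hK'c hle'
    refine le_antisymm (fun y hy => ?_) hle
    have hy' : e.symm y ∈ K := by rw [← heq]; exact ⟨y, hy, rfl⟩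
    exact ⟨e.symm y, hy', e.apply_symm_apply y⟩

end Transport

namespace ProfiniteSemiGraph

open IwahoriWitness FreeProPRankTwo

variable (p : ℕ) [hp : Fact p.Prime]

/-! ### 1. The parametrised escaping maximal compact subgroup of `π₁^temp(𝒢⋆(p))` -/

/-- ★ **A continuous `ζ : ℤ_p →ₜ* π₁^temp(𝒢⋆(p))` parametrising the escaping exotic maximal compact subgroup**
(canonical chart, base point sequence `P₀` over the centre, every prime `p`): the limit (`exists_limitHom_range`) of
`ζ_k := Inn(h_k) ∘ ψ_{P₀} ∘ α` (`ζ_k(1) = c_k = h_k ψ_{P₀}(a) h_k⁻¹`, level-wise eventually constant by `proj_escC_succ`);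
`ρ_j(ζ 1) = ρ_j(c_k)` for `k ≥ N_j`, range `ζ = ⟨ζ 1⟩‾`, a MAXIMAL compact subgroup in NO verticial subgroup
(`escape_isMaximalCompactSubgroup`). [cite: MochizukiSemiAnbd2006, Thm 3.7(iv) p.41] -/
theorem metabelianLeafStar_exists_escapeHom (h36 : (metabelianLeafStar p).Prop36Hypotheses)
    (P₀ : ((metabelianLeafStar p).galoisLevelData h36).PointSeq h36.isCountable (leafStarCentre p)) :
    ∃ (ζ : Multiplicative ℤ_[p] →ₜ* ((metabelianLeafStar p).temperedPiChart h36).G) (N : ℕ → ℕ),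
      (∀ j k, N j ≤ k →
        ((metabelianLeafStar p).galoisLevelData h36).proj h36.isCountable j (ζ (ofAdd 1)) =
          ((metabelianLeafStar p).galoisLevelData h36).proj h36.isCountable j (escC P₀ k)) ∧
      ζ.toMonoidHom.range = (Subgroup.zpowers (ζ (ofAdd 1))).topologicalClosure ∧
      IsMaximalCompactSubgroup ζ.toMonoidHom.range ∧
      ∀ (v : (metabelianLeafStar p).graph.Vertex) (H : Subgroup ((metabelianLeafStar p).temperedPiChart h36).G),
        H ∈ verticialSubgroups ((metabelianLeafStar p).temperedPiChart h36) v → ¬ ζ.toMonoidHom.range ≤ H := by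
  -- the continuous homomorphisms `ζ_k := Inn(h_k) ∘ ψ_{P₀} ∘ α`
  let ζs : ℕ → (Multiplicative ℤ_[p] →ₜ*
      ((metabelianLeafStar p).galoisLevelData h36).temperedPi h36.isCountable) := fun k =>
    (⟨(MulAut.conj (escH P₀ k)).toMonoidHom, IsTopologicalGroup.continuous_conj (escH P₀ k)⟩ :
        ((metabelianLeafStar p).galoisLevelData h36).temperedPi h36.isCountable →ₜ*
          ((metabelianLeafStar p).galoisLevelData h36).temperedPi h36.isCountable).comp
      (P₀.decompHomCont.comp (α p))
  have hval : ∀ k, ζs k (ofAdd 1) = escC P₀ k := by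
    intro k
    change escH P₀ k * P₀.decompHom (α p (ofAdd 1)) * (escH P₀ k)⁻¹ = escC P₀ k
    rw [α_ofAdd_one]
    rfl
  -- level-wise eventual constancy at the topological generator `1` (abc-iut-L3-t8)
  have hz : ∀ n, ∃ N, ∀ k, N ≤ k →
      ((metabelianLeafStar p).galoisLevelData h36).proj h36.isCountable n (ζs (k + 1) (ofAdd 1)) =
        ((metabelianLeafStar p).galoisLevelData h36).proj h36.isCountable n (ζs k (ofAdd 1)) :=
    fun n => ⟨lvl h36 n, fun k hk => by
      rw [hval, hval]
      exact proj_escC_succ P₀ n k (hk.trans (Nat.le_succ k))⟩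
  -- the limit homomorphism (abc-iut-f-175)
  obtain ⟨ζ, hζ, hrange, hcpt⟩ := ((metabelianLeafStar p).galoisLevelData h36).exists_limitHom_range
    h36.isCountable ζs (ofAdd 1) (topologicalClosure_zpowers_ofAdd_one p) hz
  choose N hN using hζ
  have hcN : ∀ j k, N j ≤ k →
      ((metabelianLeafStar p).galoisLevelData h36).proj h36.isCountable j (ζ (ofAdd 1)) =
        ((metabelianLeafStar p).galoisLevelData h36).proj h36.isCountable j (escC P₀ k) :=
    fun j k hk => by rw [hN j k hk, hval]
  have hact : ∀ j k, N j ≤ k →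
      ((metabelianLeafStar p).galoisLevelData h36).treeAct h36.isCountable j (ζ (ofAdd 1)) =
        ((metabelianLeafStar p).galoisLevelData h36).treeAct h36.isCountable j (escC P₀ k) := fun j k hk => by
    rw [GaloisLevelData.treeAct_apply, GaloisLevelData.treeAct_apply]
    exact congrArg _ (hcN j k hk)
  have hC : IsCompact ((Subgroup.zpowers (ζ (ofAdd 1))).topologicalClosure :
      Set (((metabelianLeafStar p).galoisLevelData h36).temperedPi h36.isCountable)) := by
    rw [← hrange]
    exact hcpt
  -- abc-iut-L3-t8: every compact subgroup containing `⟨ζ 1⟩‾` equals it; `⟨ζ 1⟩‾` lies in no verticial subgroup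
  obtain ⟨hmax, hno⟩ := escape_isMaximalCompactSubgroup P₀ (ζ (ofAdd 1)) N hcN hC hact
  refine ⟨ζ, N, hcN, hrange, ?_, fun v H hH => ?_⟩
  · show IsMaximalCompactSubgroup (ζ.toMonoidHom.range :
      Subgroup (((metabelianLeafStar p).galoisLevelData h36).temperedPi h36.isCountable))
    rw [hrange]
    exact hmax
  · show ¬ (ζ.toMonoidHom.range :
      Subgroup (((metabelianLeafStar p).galoisLevelData h36).temperedPi h36.isCountable)) ≤ H
    rw [hrange]
    exact hno v H hH

/-- **`π₁^temp(𝒢⋆(p))` has an exotic maximal compact subgroup PARAMETRISED BY `ℤ_p`** (canonical chart, every prime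
`p`, hypothesis-free): a continuous `ζ : ℤ_p →ₜ* π₁^temp(𝒢⋆(p))` with range `⟨ζ 1⟩‾` a MAXIMAL compact subgroup,
COMMUTATIVE, in NO verticial subgroup, NOT verticial — the parametrised form of abc-iut-L3-t8's
`metabelianLeafStar_exists_procyclic_exotic_maximalCompact`. [cite: MochizukiSemiAnbd2006, Thm 3.7(iv) p.41] -/
theorem metabelianLeafStar_exists_hom_padicInt_range_isMaximalCompact
    (h36 : (metabelianLeafStar p).Prop36Hypotheses) :
    ∃ ζ : Multiplicative ℤ_[p] →ₜ* ((metabelianLeafStar p).temperedPiChart h36).G,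
      ζ.toMonoidHom.range = (Subgroup.zpowers (ζ (ofAdd 1))).topologicalClosure ∧
      IsMaximalCompactSubgroup ζ.toMonoidHom.range ∧
      (∀ (v : (metabelianLeafStar p).graph.Vertex) (H : Subgroup ((metabelianLeafStar p).temperedPiChart h36).G),
        H ∈ verticialSubgroups ((metabelianLeafStar p).temperedPiChart h36) v → ¬ ζ.toMonoidHom.range ≤ H) ∧
      (∀ v : (metabelianLeafStar p).graph.Vertex,
        ζ.toMonoidHom.range ∉ verticialSubgroups ((metabelianLeafStar p).temperedPiChart h36) v) ∧
      ∀ g₁ ∈ ζ.toMonoidHom.range, ∀ g₂ ∈ ζ.toMonoidHom.range, g₁ * g₂ = g₂ * g₁ := by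
  obtain ⟨P₀⟩ := GaloisLevelData.nonempty_pointSeq h36 (leafStarCentre p)
  obtain ⟨ζ, -, -, hrange, hmax, hno⟩ := metabelianLeafStar_exists_escapeHom p h36 P₀
  refine ⟨ζ, hrange, hmax, hno, fun v hv => hno v _ hv le_rfl, ?_⟩
  rintro _ ⟨t₁, rfl⟩ _ ⟨t₂, rfl⟩
  change ζ t₁ * ζ t₂ = ζ t₂ * ζ t₁
  rw [← map_mul, ← map_mul, mul_comm]

/-- **The parametrised exotic maximal compact subgroup at EVERY chart of `π₁^temp(𝒢⋆(p))`** (transport of the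
canonical-chart `ζ` along `TemperedPiChart.exists_compatIso`; verticial subgroups matched by
`mem_verticialSubgroups_iff_map`). [cite: MochizukiSemiAnbd2006, Thm 3.7(iv) p.41] -/
theorem metabelianLeafStar_exists_hom_padicInt_range_isMaximalCompact_chart
    (c : TemperedPiChart (metabelianLeafStar p)) :
    ∃ ζ : Multiplicative ℤ_[p] →ₜ* c.G, IsMaximalCompactSubgroup ζ.toMonoidHom.range ∧
      (∀ (v : (metabelianLeafStar p).graph.Vertex) (H : Subgroup c.G), H ∈ verticialSubgroups c v →
        ¬ ζ.toMonoidHom.range ≤ H) ∧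
      (∀ v : (metabelianLeafStar p).graph.Vertex, ζ.toMonoidHom.range ∉ verticialSubgroups c v) ∧
      ∀ g₁ ∈ ζ.toMonoidHom.range, ∀ g₂ ∈ ζ.toMonoidHom.range, g₁ * g₂ = g₂ * g₁ := by
  have h36 : (metabelianLeafStar p).Prop36Hypotheses := (metabelianLeafStar_thm37Hypotheses' p).toProp36Hypotheses
  obtain ⟨φ, ψ, hψφ, hφψ, hφ, hψ⟩ := TemperedPiChart.exists_compatIso ((metabelianLeafStar p).temperedPiChart h36) c
  obtain ⟨ζ₀, -, hmax₀, hno₀, -, -⟩ := metabelianLeafStar_exists_hom_padicInt_range_isMaximalCompact p h36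
  -- the compatible isomorphism of charts as a `ContinuousMulEquiv`
  let e : ((metabelianLeafStar p).temperedPiChart h36).G ≃ₜ* c.G :=
    { toFun := φ, invFun := ψ, left_inv := hψφ, right_inv := hφψ, map_mul' := map_mul φ,
      continuous_toFun := φ.continuous, continuous_invFun := ψ.continuous }
  have he : e.toMonoidHom = φ.toMonoidHom := rfl
  have hrange : (φ.comp ζ₀).toMonoidHom.range = ζ₀.toMonoidHom.range.map φ.toMonoidHom := by
    change (φ.toMonoidHom.comp ζ₀.toMonoidHom).range = _
    rw [MonoidHom.range_comp]
  have hno : ∀ (v : (metabelianLeafStar p).graph.Vertex) (H : Subgroup c.G), H ∈ verticialSubgroups c v →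
      ¬ (φ.comp ζ₀).toMonoidHom.range ≤ H := by
    intro v H hH hle
    have hH' : H.map ψ.toMonoidHom ∈ verticialSubgroups ((metabelianLeafStar p).temperedPiChart h36) v :=
      (mem_verticialSubgroups_iff_map φ hφ ψ hφψ hψ H).mp hH
    refine hno₀ v _ hH' fun x hx => ?_
    rw [hrange] at hle
    exact ⟨φ x, hle ⟨x, hx, rfl⟩, hψφ x⟩
  refine ⟨φ.comp ζ₀, ?_, hno, fun v hv => hno v _ hv le_rfl, ?_⟩
  · rw [hrange, ← he]
    exact isMaximalCompactSubgroup_map_equiv e hmax₀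
  · rintro _ ⟨t₁, rfl⟩ _ ⟨t₂, rfl⟩
    change (φ.comp ζ₀) t₁ * (φ.comp ζ₀) t₂ = (φ.comp ζ₀) t₂ * (φ.comp ζ₀) t₁
    rw [← map_mul, ← map_mul, mul_comm]

/-! ### 2. The pair (`OneVertex.graph F̂₂⁽ᵖ⁾`, `𝒢⋆(p)`): the fold `φ := ζ ∘ χ_a` -/

/-- **The witness at the pair (`OneVertex.graph F̂₂⁽ᵖ⁾`, `𝒢⋆(p)`)** (abc-iut-L3-t2's explicit source chart
`π₁^temp = F̂₂⁽ᵖ⁾`, EVERY chart `c` of the star): `φ := ζ ∘ χ_a` maps `F̂₂⁽ᵖ⁾` ONTO the exotic maximal compact `range ζ`;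
it is COMPATIBLY QUASI-GEOMETRIC (the only maximal compact subgroup of the compact source is `⊤`; the two-subgroup
clauses are vacuous), its range is maximal compact and NOT verticial, and NO morphism `OneVertex.graph F̂₂⁽ᵖ⁾ → 𝒢⋆(p)`
is compatible with `φ` on verticial homomorphisms (`not_compatV_of_range_not_le`) — hence none induces `φ`
(`InducesCompatible_holds`) or induces it up to twist (`Hom.compat_of_inducesUpToTwist`).
[cite: MochizukiSemiAnbd2006, Cor 3.9 pp.42-43] -/
theorem oneVertex_metabelianLeafStar_exists_isCompatiblyQuasiGeometric_forall_not_compatV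
    (c : TemperedPiChart (metabelianLeafStar p)) :
    ∃ (c𝒱 : TemperedPiChart (OneVertex.graph (Grp p))) (φ : c𝒱.G →ₜ* c.G),
      IsCompatiblyQuasiGeometric φ ∧ IsMaximalCompactSubgroup φ.toMonoidHom.range ∧
      (∀ v : (metabelianLeafStar p).graph.Vertex, φ.toMonoidHom.range ∉ verticialSubgroups c v) ∧
      ∀ F : Hom (OneVertex.graph (Grp p)) (metabelianLeafStar p),
        ¬ F.CompatV c𝒱 c φ ∧ ¬ F.Induces c𝒱 c φ ∧ ¬ F.InducesUpToTwist c𝒱 c φ := by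
  obtain ⟨L⟩ := nonempty_levelFamily_grp p
  haveI : SecondCountableTopology (Grp p) := secondCountableTopology_grp p
  obtain ⟨ζ, hmax, hno, hnot, -⟩ := metabelianLeafStar_exists_hom_padicInt_range_isMaximalCompact_chart p c
  have h37 : (metabelianLeafStar p).Thm37Hypotheses := metabelianLeafStar_thm37Hypotheses' p
  have h𝒱 : Cor39Hypotheses (OneVertex.graph (Grp p)) :=
    ⟨OneVertex.prop36Hypotheses L (isSlimGroup p), OneVertex.isTotallyEstranged, ⟨fun b => nomatch b⟩⟩
  have hrange : (ζ.comp (χa p)).toMonoidHom.range = ζ.toMonoidHom.range := by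
    change (ζ.toMonoidHom.comp (χa p).toMonoidHom).range = _
    rw [MonoidHom.range_comp, MonoidHom.range_eq_top.mpr (χa_surjective p), ← MonoidHom.range_eq_map]
  have hnv : ¬ ∃ (v : (metabelianLeafStar p).graph.Vertex) (H : Subgroup c.G),
      H ∈ verticialSubgroups c v ∧ (ζ.comp (χa p)).toMonoidHom.range ≤ H := by
    rintro ⟨v, H, hH, hle⟩
    rw [hrange] at hle
    exact hno v H hH hle
  have hV : ∀ F : Hom (OneVertex.graph (Grp p)) (metabelianLeafStar p),
      ¬ F.CompatV (OneVertex.chart L) c (ζ.comp (χa p)) :=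
    fun F => not_compatV_of_range_not_le L h37 c (ζ.comp (χa p)) hnv F
  have hmax' : IsMaximalCompactSubgroup (ζ.comp (χa p)).toMonoidHom.range := by
    rw [hrange]
    exact hmax
  have hnot' : ∀ v : (metabelianLeafStar p).graph.Vertex,
      (ζ.comp (χa p)).toMonoidHom.range ∉ verticialSubgroups c v := by
    rw [hrange]
    exact hnot
  refine ⟨OneVertex.chart L, ζ.comp (χa p), ?_, ?_, ?_, fun F => ⟨hV F, fun hind => ?_, fun hind => ?_⟩⟩
  · exact isCompatiblyQuasiGeometric_of_range_isMaximalCompactSubgroup (ζ.comp (χa p)) hmax'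
  · exact hmax'
  · exact hnot'
  · exact hV F (InducesCompatible_holds (OneVertex.graph (Grp p)) (metabelianLeafStar p) h𝒱
      (metabelianLeafStar_cor39Hypotheses p) (OneVertex.chart L) c F _ hind).1
  · exact hV F (F.compat_of_inducesUpToTwist (OneVertex.chart L) c _ hind).1

/-- ★ **Clause (b) of [SemiAnbd] Cor. 3.9 up to twist FAILS at the pair (`OneVertex.graph F̂₂⁽ᵖ⁾`, `𝒢⋆(p)`)**
(explicit source chart, EVERY target chart, every prime `p`): NOT every compatibly quasi-geometric `φ` is induced up to
twist by a locally open morphism — the fold `ζ ∘ χ_a` is induced up to twist by NO morphism at all (def-free currency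
of abc-iut-w4-d080: `∃ θ, B^temp(φ) ≅ c_H⁻¹ ⋙ F^*_θ ⋙ c_G`). [cite: MochizukiSemiAnbd2006, Cor 3.9 pp.42-43] -/
theorem oneVertex_metabelianLeafStar_not_cor39b (c : TemperedPiChart (metabelianLeafStar p)) :
    ∃ c𝒱 : TemperedPiChart (OneVertex.graph (Grp p)),
      ¬ ∀ φ : c𝒱.G →ₜ* c.G, IsCompatiblyQuasiGeometric φ →
        ∃ F : Hom (OneVertex.graph (Grp p)) (metabelianLeafStar p), F.IsLocallyOpen ∧
          ∃ θ : F.ConjugatorFamily, Nonempty (F.chartPullbackWith θ c𝒱 c ≅ BTemp.res φ) := by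
  obtain ⟨c𝒱, φ, hφ, -, -, hF⟩ :=
    oneVertex_metabelianLeafStar_exists_isCompatiblyQuasiGeometric_forall_not_compatV p c
  refine ⟨c𝒱, fun h => ?_⟩
  obtain ⟨F, -, hind⟩ := h φ hφ
  exact (hF F).2.2 hind

/-- ★ **At the pair (`OneVertex.graph F̂₂⁽ᵖ⁾`, `𝒢⋆(p)`) clause (a) of [SemiAnbd] Cor. 3.9 up to twist HOLDS while
clause (b) FAILS** (explicit source chart, every target chart): (a) because the source is FINITE (p501002's (iii)-free
quadrant `metabelianLeafStar_cor39a_upToTwistAt_target_of_finite`), ¬(b) by the fold.  Mirror image of this lineage's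
pair (`𝒢_θ(p, n)`, `loopGraph p`) of p496623 ((a) fails, (b) holds). [cite: MochizukiSemiAnbd2006, Cor 3.9 pp.42-43] -/
theorem oneVertex_metabelianLeafStar_cor39a_and_not_cor39b (c : TemperedPiChart (metabelianLeafStar p)) :
    ∃ c𝒱 : TemperedPiChart (OneVertex.graph (Grp p)),
      (∀ (F : Hom (OneVertex.graph (Grp p)) (metabelianLeafStar p)), F.IsLocallyOpen →
        ∀ φ : c𝒱.G →ₜ* c.G, F.InducesUpToTwist c𝒱 c φ → IsCompatiblyQuasiGeometric φ) ∧
      ¬ ∀ φ : c𝒱.G →ₜ* c.G, IsCompatiblyQuasiGeometric φ →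
        ∃ F : Hom (OneVertex.graph (Grp p)) (metabelianLeafStar p), F.IsLocallyOpen ∧
          F.InducesUpToTwist c𝒱 c φ := by
  obtain ⟨L⟩ := nonempty_levelFamily_grp p
  obtain ⟨c𝒱, hb⟩ := oneVertex_metabelianLeafStar_not_cor39b p c
  have h𝒱 : Cor39Hypotheses (OneVertex.graph (Grp p)) :=
    ⟨OneVertex.prop36Hypotheses L (isSlimGroup p), OneVertex.isTotallyEstranged, ⟨fun b => nomatch b⟩⟩
  haveI : Finite (OneVertex.graph.{0} (Grp p)).graph.Vertex := inferInstanceAs (Finite PUnit)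
  haveI : Finite (OneVertex.graph.{0} (Grp p)).graph.Edge := inferInstanceAs (Finite PEmpty)
  exact ⟨c𝒱, ⟨fun F hF φ hind =>
    metabelianLeafStar_cor39a_upToTwistAt_target_of_finite p h𝒱 c𝒱 c F hF φ hind, hb⟩⟩

/-! ### 3. The ¬∀ currencies and the quadrant table at the rayless star -/

/-- ★ **Thm. 3.7 (iii) at the TARGET is NECESSARY in the top-cyclic cell of Cor. 3.9 (b)** (p501002,
`cor39b_upToTwist_baseAt_of_topCyclic_source`): it is FALSE that at every pair (`G`, `H`) of Cor-3.9 graphs ALL of whose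
edge groups are topologically cyclic — even with Thm. 3.7 (iii) AT THE SOURCE — every compatibly quasi-geometric `φ` is
induced up to twist by a locally open `F : G → H`.  Witness (`OneVertex.graph F̂₂⁽²⁾`, `𝒢⋆(2)`): no edge at the source,
edge groups `ℤ_2` at the target (`metabelianLeafStar_topCyclic`). [cite: MochizukiSemiAnbd2006, Cor 3.9 pp.42-43] -/
theorem not_forall_topCyclic_cor39b :
    ¬ ∀ (𝒢 ℋ : ProfiniteSemiGraph.{0}),
        (∀ e : 𝒢.graph.Edge, ∃ t₀ : 𝒢.Ge e, (Subgroup.zpowers t₀).topologicalClosure = ⊤) →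
        (∀ e : ℋ.graph.Edge, ∃ t₀ : ℋ.Ge e, (Subgroup.zpowers t₀).topologicalClosure = ⊤) →
        CompactInVerticialAt 𝒢 → Cor39Hypotheses 𝒢 → Cor39Hypotheses ℋ →
        ∀ (c𝒢 : TemperedPiChart 𝒢) (cℋ : TemperedPiChart ℋ) (φ : c𝒢.G →ₜ* cℋ.G),
          IsCompatiblyQuasiGeometric φ → ∃ F : Hom 𝒢 ℋ, F.IsLocallyOpen ∧ F.InducesUpToTwist c𝒢 cℋ φ := by
  intro h
  haveI : Fact (Nat.Prime 2) := ⟨Nat.prime_two⟩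
  obtain ⟨L⟩ := nonempty_levelFamily_grp 2
  have h36 : (metabelianLeafStar 2).Prop36Hypotheses := (metabelianLeafStar_thm37Hypotheses' 2).toProp36Hypotheses
  obtain ⟨c𝒱, hb⟩ := oneVertex_metabelianLeafStar_not_cor39b 2 ((metabelianLeafStar 2).temperedPiChart h36)
  have h𝒱 : Cor39Hypotheses (OneVertex.graph (Grp 2)) :=
    ⟨OneVertex.prop36Hypotheses L (isSlimGroup 2), OneVertex.isTotallyEstranged, ⟨fun b => nomatch b⟩⟩
  have h𝒱iii : CompactInVerticialAt (OneVertex.graph.{0} (Grp 2)) :=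
    compactInVerticialAt_of_finiteGraph' (inferInstanceAs (Finite PUnit)) (inferInstanceAs (Finite PEmpty))
  exact hb (h (OneVertex.graph (Grp 2)) (metabelianLeafStar 2) (fun e => nomatch e) (metabelianLeafStar_topCyclic 2)
    h𝒱iii h𝒱 (metabelianLeafStar_cor39Hypotheses 2) c𝒱 _)

/-- **Contrast, same quantifier shape: with Thm. 3.7 (iii) at the TARGET the statement HOLDS at every top-cyclic
source** (p501002's `cor39b_compatUpToTwistAt_of_topCyclic_source`, existence part).
[cite: MochizukiSemiAnbd2006, Cor 3.9 pp.42-43] -/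
theorem forall_topCyclic_source_cor39b_of_compactInVerticialAt_target :
    ∀ (𝒢 ℋ : ProfiniteSemiGraph.{0}),
        (∀ e : 𝒢.graph.Edge, ∃ t₀ : 𝒢.Ge e, (Subgroup.zpowers t₀).topologicalClosure = ⊤) →
        CompactInVerticialAt ℋ → Cor39Hypotheses 𝒢 → Cor39Hypotheses ℋ →
        ∀ (c𝒢 : TemperedPiChart 𝒢) (cℋ : TemperedPiChart ℋ) (φ : c𝒢.G →ₜ* cℋ.G),
          IsCompatiblyQuasiGeometric φ → ∃ F : Hom 𝒢 ℋ, F.IsLocallyOpen ∧ F.InducesUpToTwist c𝒢 cℋ φ :=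
  fun _ _ hcyc𝒢 hℋiii h𝒢 hℋ c𝒢 cℋ φ hφ => by
    obtain ⟨F, hF, hind, -⟩ := cor39b_compatUpToTwistAt_of_topCyclic_source hcyc𝒢 hℋiii h𝒢 hℋ c𝒢 cℋ φ hφ
    exact ⟨F, hF, hind⟩

/-- ★ **At the TARGET, the first sentence of Thm. 3.7 (iii) cannot be traded for (R3c) + topologically cyclic edge
groups**: a countable Cor-3.9 graph `H` (`𝒢⋆(2)`) with topologically cyclic edge groups, `EdgeLikeCentralizerAt H c` at
EVERY chart (step (R3c) of the proof of Cor. 3.9 p. 43; abc-iut-w6-d064), NOT locally finite, FAILING Thm. 3.7 (iii),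
and a FINITE Cor-3.9 graph `G` satisfying Thm. 3.7 (iii), such that at every chart of `H` some chart of `G` carries a
compatibly quasi-geometric `φ` induced up to twist by NO locally open `G → H`. [cite: MochizukiSemiAnbd2006, Cor 3.9 pp.42-43] -/
theorem exists_edgeLikeCentralizerAt_not_compactInVerticialAt_target_not_cor39b :
    ∃ 𝒢 ℋ : ProfiniteSemiGraph.{0}, Cor39Hypotheses 𝒢 ∧ Cor39Hypotheses ℋ ∧
      Finite 𝒢.graph.Vertex ∧ Finite 𝒢.graph.Edge ∧ CompactInVerticialAt 𝒢 ∧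
      (∀ e : ℋ.graph.Edge, ∃ t₀ : ℋ.Ge e, (Subgroup.zpowers t₀).topologicalClosure = ⊤) ∧
      (∀ c : TemperedPiChart ℋ, EdgeLikeCentralizerAt ℋ c) ∧
      ¬ ℋ.graph.IsLocallyFinite ∧ ¬ CompactInVerticialAt ℋ ∧
      ∀ cℋ : TemperedPiChart ℋ, ∃ c𝒢 : TemperedPiChart 𝒢,
        ¬ ∀ φ : c𝒢.G →ₜ* cℋ.G, IsCompatiblyQuasiGeometric φ →
          ∃ F : Hom 𝒢 ℋ, F.IsLocallyOpen ∧ F.InducesUpToTwist c𝒢 cℋ φ := by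
  haveI : Fact (Nat.Prime 2) := ⟨Nat.prime_two⟩
  obtain ⟨L⟩ := nonempty_levelFamily_grp 2
  have h𝒱 : Cor39Hypotheses (OneVertex.graph (Grp 2)) :=
    ⟨OneVertex.prop36Hypotheses L (isSlimGroup 2), OneVertex.isTotallyEstranged, ⟨fun b => nomatch b⟩⟩
  have hV : Finite (OneVertex.graph.{0} (Grp 2)).graph.Vertex := inferInstanceAs (Finite PUnit)
  have hE : Finite (OneVertex.graph.{0} (Grp 2)).graph.Edge := inferInstanceAs (Finite PEmpty)
  refine ⟨OneVertex.graph (Grp 2), metabelianLeafStar 2, h𝒱, metabelianLeafStar_cor39Hypotheses 2, hV, hE,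
    compactInVerticialAt_of_finiteGraph' hV hE, metabelianLeafStar_topCyclic 2,
    metabelianLeafStar_edgeLikeCentralizerAt 2, (metabelianLeafStar_isConnected_isCountable_hasVertex 2).2.2.2.2,
    metabelianLeafStar_not_compactInVerticialAt 2, fun cℋ => oneVertex_metabelianLeafStar_not_cor39b 2 cℋ⟩

/-- ★ **The quadrant table of «Cor. 3.9 up to twist at the rayless star `𝒢⋆(p)`»** (every prime `p`, every chart of
the star): (a) with TARGET `𝒢⋆(p)` ✓ and (b) with SOURCE `𝒢⋆(p)` ✓ (base unique) for every partner satisfying Thm. 3.7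
(iii) (p501002) · (b) with TARGET `𝒢⋆(p)` ✗ already for a FINITE Cor-3.9 partner satisfying Thm. 3.7 (iii) (this file).
NOT decided here: (a) with source `𝒢⋆(p)`; (b) with target `𝒢⋆(p)` for sources in which every vertex carries an edge.
[cite: MochizukiSemiAnbd2006, Cor 3.9 pp.42-43] -/
theorem metabelianLeafStar_cor39UpToTwist_quadrants :
    (∀ (𝒦 : ProfiniteSemiGraph.{0}), CompactInVerticialAt 𝒦 → Cor39Hypotheses 𝒦 →
      ∀ (c𝒦 : TemperedPiChart 𝒦) (c : TemperedPiChart (metabelianLeafStar p))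
        (F : Hom 𝒦 (metabelianLeafStar p)), F.IsLocallyOpen → ∀ φ : c𝒦.G →ₜ* c.G,
          F.InducesUpToTwist c𝒦 c φ → IsCompatiblyQuasiGeometric φ) ∧
    (∀ (ℋ : ProfiniteSemiGraph.{0}), CompactInVerticialAt ℋ → Cor39Hypotheses ℋ →
      ∀ (c : TemperedPiChart (metabelianLeafStar p)) (cℋ : TemperedPiChart ℋ) (φ : c.G →ₜ* cℋ.G),
        IsCompatiblyQuasiGeometric φ →
          ∃ F : Hom (metabelianLeafStar p) ℋ, F.IsLocallyOpen ∧ F.InducesUpToTwist c cℋ φ ∧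
            ∀ F' : Hom (metabelianLeafStar p) ℋ, F'.IsLocallyOpen → F'.InducesUpToTwist c cℋ φ →
              F'.base = F.base) ∧
    ∃ 𝒦 : ProfiniteSemiGraph.{0}, Cor39Hypotheses 𝒦 ∧ Finite 𝒦.graph.Vertex ∧ Finite 𝒦.graph.Edge ∧
      CompactInVerticialAt 𝒦 ∧
      ∀ c : TemperedPiChart (metabelianLeafStar p), ∃ c𝒦 : TemperedPiChart 𝒦,
        ¬ ∀ φ : c𝒦.G →ₜ* c.G, IsCompatiblyQuasiGeometric φ →
          ∃ F : Hom 𝒦 (metabelianLeafStar p), F.IsLocallyOpen ∧ F.InducesUpToTwist c𝒦 c φ := by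
  obtain ⟨L⟩ := nonempty_levelFamily_grp p
  have h𝒱 : Cor39Hypotheses (OneVertex.graph (Grp p)) :=
    ⟨OneVertex.prop36Hypotheses L (isSlimGroup p), OneVertex.isTotallyEstranged, ⟨fun b => nomatch b⟩⟩
  have hV : Finite (OneVertex.graph.{0} (Grp p)).graph.Vertex := inferInstanceAs (Finite PUnit)
  have hE : Finite (OneVertex.graph.{0} (Grp p)).graph.Edge := inferInstanceAs (Finite PEmpty)
  refine ⟨fun _ h𝒦iii h𝒦 c𝒦 c F hF φ hind =>
      metabelianLeafStar_cor39a_upToTwistAt_target p h𝒦iii h𝒦 c𝒦 c F hF φ hind,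
    fun _ hℋiii hℋ c cℋ φ hφ => metabelianLeafStar_cor39b_upToTwist_baseAt_source p hℋiii hℋ c cℋ φ hφ,
    OneVertex.graph (Grp p), h𝒱, hV, hE, compactInVerticialAt_of_finiteGraph' hV hE, fun c => ?_⟩
  obtain ⟨c𝒱, hb⟩ := oneVertex_metabelianLeafStar_cor39a_and_not_cor39b p c
  exact ⟨c𝒱, hb.2⟩

end ProfiniteSemiGraph

end Literature.AnabelianGeometry.SemiGraphs

end
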